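import Summits.BirchSwinnertonDyer.Rank1Residual.X2.SelmerCotorsionOfFiniteTorsion
import Summits.BirchSwinnertonDyer.Rank1Residual.X2.NonPrimitiveSelmerTorsionCard
import HarnessLib

/-!
# `Sel_{p^∞}(E/K_∞)[p]` finite ⟺ `X(E/K_∞)` is `Λ`-torsion with `μ = 0` (Greenberg's criterion as an
# EQUIVALENCE; cell `b2b-bsdres`, unit `b2b-bsdres-eisenstein-p2`, gen 22, corollary file)

HONEST FRAMING (BSD rank-`≤ 1` residual cell `b2b-bsdres`, home
`run/shared/lean/b2b/bsd-rank1-residual/`, unit `b2b-bsdres-eisenstein-p2`, class X2; research route,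
no claim beyond stated classes; nothing booked here; labels unchanged): the cell deletes the
COMBINATION-SHAPED residual classes of the rank-`≤ 1` BSD formula from PUBLISHED theorems only and
TYPES the construction-shaped ones; this is not "finishing BSD". Theorems only (no definition, no
named fact, nothing asserted).

Greenberg, LNM 1716, proof of Prop. 5.10 (PDF p. 147): "We will show that `Sel_E(ℚ_∞)[p]` is finite.
This obviously implies the conclusion." Gen 22's `SelmerCotorsionOfFiniteTorsion` proved the
implication; this file records the CONVERSE (structure theory: `μ(X) = 0 ⟺ X` finitely generated
over `ℤ_p` for torsion `X`, tree `muInvariant_eq_zero_iff_finite`; then `Hom(X/pX, ℚ/ℤ) ⊇ Sel[p]`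
is finite, gen 11 `finite_torsionBy_of_addEquiv`) and states the criterion as an `iff`, so that the
conclusion of Greenberg's Prop. 5.10 (= the registered fact A61's body: `D.IsTorsion ∧ char = (g)`,
`g` of unit content) and "`Sel_∞[p]` finite" are interchangeable in the kernel — e.g. a
`(μ_an, λ_an)` certificate + Kato–Wuthrich divisibility gives `Sel_∞[p]` finite, and conversely any
finiteness certificate for `Sel_∞[p]` gives cotorsion with `μ = 0`.

* `finite_torsionBy_of_isTorsion_of_mu_eq_zero` — torsion ∧ `μ = 0` ⇒ `Sel_∞[p]` finite (any
  `ℤ_p`-extension, any dual datum with `X` finitely generated);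
* `finite_torsionBy_iff_isTorsion_and_mu_eq_zero` — the equivalence (cyclotomic `κ`);
* `finite_torsionBy_iff_isTorsion_and_exists_hasUnitContent` — the same with A61's phrasing.

References: R. Greenberg, LNM 1716 (1999), Prop. 5.10 (PDF p. 147), §1 p. 61; Washington §13.2.
-/

noncomputable section

open scoped Classical AddSubgroup

universe u

namespace Summit.BirchSwinnertonDyer.Rank1Residual.X2.SelmerCotorsionCriterion

open Literature.NumberTheory.EllipticCurves NumberField WeierstrassCurve
  Literature.NumberTheory.EllipticCurves.GreenbergVatsal2000
  Summit.BirchSwinnertonDyer.Rank1Residual.X2.NonPrimitiveSelmerTorsionCard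
  Summit.BirchSwinnertonDyer.Rank1Residual.X2.SelmerCotorsionOfFiniteTorsion

variable {K : Type u} [Field K] [NumberField K] (W : WeierstrassCurve K) [W.IsElliptic]
  {p : ℕ} [hp : Fact p.Prime] {κ : ZpExtension K p} {γ : Field.absoluteGaloisGroup K}

omit [W.IsElliptic] in
/-- **Torsion ∧ `μ = 0` ⇒ `Sel_{p^∞}(E/K_∞)[p]` finite** (any `ℤ_p`-extension `κ`, any Pontryagin-dual
datum `D` with `X` finitely generated over `Λ`): `μ(X) = 0` makes `X` finitely generated over `ℤ_p`
(tree `muInvariant_eq_zero_iff_finite`), and an abelian group whose character group is a finitely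
generated `ℤ_p`-module has finite `p`-torsion (gen 11 `finite_torsionBy_of_addEquiv`).
[cite: GreenbergLNM1716, Prop. 5.10 (proof, PDF p. 147)] [cite: Washington1997, §13.2] -/
theorem finite_torsionBy_of_isTorsion_of_mu_eq_zero (D : W.SelmerDualData κ γ)
    [Module.Finite (IwasawaAlgebra p) D.X] (hX : D.IsTorsion) (hμ : D.mu = 0) :
    Finite ((↥(W.selmerInfty κ))[(p : ℤ)]) := by
  letI : Module ℤ_[p] D.X := Module.compHom D.X (algebraMap ℤ_[p] (IwasawaAlgebra p))
  haveI : IsScalarTower ℤ_[p] (IwasawaAlgebra p) D.X := IsScalarTower.of_compHom ℤ_[p] _ D.X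
  haveI : Module.Finite ℤ_[p] D.X := moduleFinite_int_of_muInvariant_eq_zero p D.X hX hμ
  exact finite_torsionBy_of_addEquiv p (AddEquiv.ofBijective D.toDual D.bijective)

/-- **Greenberg's criterion as an equivalence** (cyclotomic `κ` with topological generator `γ`, any
dual datum `D`): `Sel_{p^∞}(E/K_∞)[p]` is finite **iff** `X(E/K_∞)` is `Λ`-torsion with `μ = 0`.
(`⇒`: gen 22 `isTorsion_and_exists_hasUnitContent_of_finite_torsionBy`, Nakayama + Cayley–Hamilton;
`⇐`: the previous theorem, finite generation being automatic for cyclotomic `κ`.)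
[cite: GreenbergLNM1716, Prop. 5.10 (proof, PDF p. 147)] -/
theorem finite_torsionBy_iff_isTorsion_and_mu_eq_zero (hκ : κ.IsCyclotomic)
    (hγ : κ.IsTopGenerator γ) (D : W.SelmerDualData κ γ) :
    Finite ((↥(W.selmerInfty κ))[(p : ℤ)]) ↔ D.IsTorsion ∧ D.mu = 0 := by
  haveI : Module.Finite (IwasawaAlgebra p) D.X :=
    SelmerDualData.module_finite_of_isCyclotomic (W := W) (κ := κ) hκ D hγ
  constructor
  · intro hfin
    obtain ⟨hX, g, hg, hug⟩ := isTorsion_and_exists_hasUnitContent_of_finite_torsionBy W hκ hγ D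
    exact ⟨hX, (mu_eq_zero_iff_hasUnitContent D hX hg).mpr hug⟩
  · rintro ⟨hX, hμ⟩
    exact finite_torsionBy_of_isTorsion_of_mu_eq_zero W D hX hμ

/-- The same equivalence in the phrasing of Greenberg's Prop. 5.10 / the registered fact A61
(`char_Λ X = (g)` with `g` of unit content). [cite: GreenbergLNM1716, Prop. 5.10 (PDF p. 147)] -/
theorem finite_torsionBy_iff_isTorsion_and_exists_hasUnitContent (hκ : κ.IsCyclotomic)
    (hγ : κ.IsTopGenerator γ) (D : W.SelmerDualData κ γ) :
    Finite ((↥(W.selmerInfty κ))[(p : ℤ)]) ↔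
      D.IsTorsion ∧ ∃ g : IwasawaAlgebra p, D.charIdeal = Ideal.span {g} ∧ HasUnitContent g := by
  haveI : Module.Finite (IwasawaAlgebra p) D.X :=
    SelmerDualData.module_finite_of_isCyclotomic (W := W) (κ := κ) hκ D hγ
  constructor
  · intro hfin
    exact isTorsion_and_exists_hasUnitContent_of_finite_torsionBy W hκ hγ D
  · rintro ⟨hX, g, hg, hug⟩
    exact finite_torsionBy_of_isTorsion_of_mu_eq_zero W D hX
      ((mu_eq_zero_iff_hasUnitContent D hX hg).mpr hug)

end Summit.BirchSwinnertonDyer.Rank1Residual.X2.SelmerCotorsionCriterion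

end
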